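import Summits.QuantumFields.YangMills.Theorems.AlphaInputsT3ACPint
import HarnessLib

/-!
# (U″) — THE UPPER HALF OF THE UNIT ENVELOPE MODULO THE T3 (α) PACKAGE AND ONE ROW: `ρ_K ≤ exp(−E_K + Cu')` a.e., K-UNIFORMLY, from (41)′ at the top level,
# (46), the remainder size and the shape of the history functional, GIVEN the top-level large-field control (the END theorem's leaf B25 at `k = K`);
# and the registered `stub_unitEnvelope` text from the package, that leaf and the membership row

Cell `ym3-torus` (YM ladder rung R3 = continuum `SU(2)` Yang–Mills on the three-torus — a RUNG, NOT d = 4, NOT infinite volume, NOT a mass gap, NOT Clay).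
Twin-width seat `ym-ust-19936-w8` (gen 11); `--supports stmt-QuantumFields-19936 --as helper`, count-neutral, definition-free, default heartbeats.
Crux `UnitScaleTilt.HistoryTailL` (stmt-QuantumFields-19936), skeleton of record `Cruxes/HistoryTailL/Lines/pinned_stability.lean` v2′ (★★OWNER RECORD 17aq): row R-19936-U =
`stub_unitEnvelope` = (U″) [THIS FILE, modulo ONE displayed row] + (L″) [✓`UV3UnitPartitionLowerOfPackage`, `ym3-torus-px12` g12, modulo the membership row; its `hPint` row
✓`AlphaInputsT3ACPint`] + the knit ✓`UV3UnitPartitionLowerOfPackage.unitEnvelope_of_halves`.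

THE POINT.  Print's Theorem 1 upper bound `ρ_K ≤ e^{−E_K + O(1)|T₁|}` ((5) p.256 ⇐ (41) p.266 + the large-field resummation (67)–(71) p.273 + [9] §3.C) splits, on the
interface datum `D : AlphaDataT3 F γ`, into rows the (α) socket `AlphaInputsT3AC.Of F 𝔠` already DELIVERS — (41)′ a.e. (`dataT3_ineq41AE`: `ρ_K ≤ e^{−Ecst_K + Rm_K}·up_K`,
`up_K(W) = LF_K(W)[h ↦ e^{−mainT + Pint + Zterm}]`), the remainder size (`dataT3_exp_two_Rm_le`), the shape of `LF` (`dataT3_lfShape`: monotone, `LF(Φ + t) = eᵗ·LF(Φ)`),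
(46) at the top level for EVERY history (✓`AlphaInputsT3ACPint.abs_dataT3_Pint_top_le`: `Pint_K(h, W) ≤ CP`, K-uniform) — and ONE row it does not: the TOP-LEVEL LARGE-FIELD
CONTROL `LF_K(W)[h ↦ e^{−mainT_K(h,W) + Zterm_K(h)}] ≤ e^{CZ}`, K-uniformly in `W` — the text of the END theorem's analytic leaf B25 `UVStability3D.AnalyticLeaves.lf`
(`∀ k ≤ K, LF k U (−mainT + Zterm) ≤ exp(d·|T₁^{(k)}|)`) READ AT `k = K` ONLY, where `|T₁^{(K)}| = (2L^m)³` does not depend on the run (pp. 273–274 «The analysis of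
Sect. 3.C [9], which is model independent, show that these small factors are enough to control all sums in (41)»; in the tree for the Haar-compatible lane tower —
`Balaban3D.Proofs.LargeFieldStd.lf_stdTowerInput` — and the HYPOTHESIS `hlf` of ✓`BalabanUVNodesN08SlotOfRecordFromAlphaAC.nonempty_analyticLeaves_towerOfAC_of_alphaAC_of_lf`
for the AC tower the socket uses: the one leaf whose lane proof consumes `mass ≤ 1`).  So:
* §1 ★★ `ae_emlDensity_top_le_of_rows` — GENERIC over a datum `D`: (41)′_K a.e. ∧ `LFShape` ∧ `Rm_K ≤ CR` ∧ `Pint_K ≤ CP` (all histories) ∧ the top-level large-field row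
  ⟹ `∃ Cu', ∀ K, ∀ᵐ W, ρ_K W ≤ exp(−D.Ecst K K + Cu')`, `Cu' := CR + CP + CZ`.
* §2 ★★ `AlphaInputsT3AC.Of.ae_emlDensity_top_le_of_lf` — at the socket datum `dataT3`: every row BY NAME except the large-field row `hlf` (displayed).
* §3 ★★★ `AlphaInputsT3AC.Of.unitEnvelope_letter_of_lf_of_main` — the LETTER of `stub_unitEnvelope` per `(F, γ)` (`∃ Cl', ∀ K, ∀ᵐ V, ρ_K V ≤ e^{Cl'}·Z_K`) from the package,
  `hlf` and the membership∕main-term row `hMain` of (L″): ✓`unitEnvelope_of_halves` at the anchor `E K := Ecst K K` over §2 and ✓`exp_Ecst_le_partitionFn_of_package_of_main`.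
* §4 ★★★ `stub_unitEnvelope_of_package_of_lf_of_main` — THE REGISTERED STUB TEXT `PinnedStability.stub_unitEnvelope` VERBATIM (`∀ L, ∃ γ₁ > 0, ∀ F γ, F.L = L → 0 < γ → γ ≤ γ₁ →
  ∃ Cl, ∀ K, ∀ᵐ V, …`) from THREE NAMED ROWS quantified over the families: the socket `∀ L, AlphaInputsT3AC L` (the UV3 node, closed modulo its Tier A–E inputs),
  the top-level large-field row, the top-level main-term row; `γ₁ := (min γ₀ 1)²` of the socket's record.  A FACE: conclusion = the stub's text, hypotheses = named rows;
  it closes nothing.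

HONEST SCOPE.  Bookkeeping over landed rows; the weight of `stub_unitEnvelope`'s upper half is ENTIRELY in the displayed row `hlf` (= R-19936-S's resummation organ at the
trivial pin, ★★OWNER RECORD 17aq — here named ONCE, as the END theorem's B25 text at `k = K`), and of its lower half in `hMain` (the EX lane).  CONDITIONAL on
`AlphaInputsT3AC.Of F 𝔠`; nothing of (41)'s pinned form (S-step), of B25 for the AC tower, of `stub_pinnedRatio`∕`hP`, of `HistoryTailL` (19936) or of the rung is proved
here.  Sorry-free, axioms standard.

References: T. Bałaban, *Ultraviolet stability of three-dimensional lattice pure gauge field theories*, Commun. Math. Phys. **102** (1985) 255–275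
[Balaban1985UV3] ((5)–(6) pp.256–257, (41) p.266, (46)–(47) p.267, (67)–(71) p.273, pp.273–274); T. Bałaban, *(Higgs)₂,₃ quantum fields in a finite volume. II.
An upper bound*, Commun. Math. Phys. **86** (1982) 555–594 [Balaban1982Higgs2] (§3.C).
-/

set_option autoImplicit false

noncomputable section

namespace Summit.QuantumFields.YangMills.Theorems.UV3UnitDensityUpperOfPackage

open MeasureTheory
open Literature.MathematicalPhysics.QuantumFieldTheory.Balaban1983to89
open Literature.MathematicalPhysics.QuantumFieldTheory.Balaban1983to89.T3ContinuumYM3Torus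
open Literature.MathematicalPhysics.QuantumFieldTheory.Balaban1983to89.T3UnitLawDensityEML (ℰp emlDensity)
open Literature.MathematicalPhysics.QuantumFieldTheory.Balaban1983to89.T3UnitScaleTilt (θBal)
open Literature.MathematicalPhysics.QuantumFieldTheory.Balaban1983to89.T3RestrictedUnitDensity (resDensity)
open Literature.MathematicalPhysics.QuantumFieldTheory.Balaban1983to89.T3AlphaInputsAC
open Literature.MathematicalPhysics.QuantumFieldTheory.Balaban1985CMP102
open Literature.MathematicalPhysics.QuantumFieldTheory.Balaban1985CMP102.Setting
open Summit.QuantumFields.Balaban3D.Carriers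
open Summit.QuantumFields.Balaban3D.Proofs.Primitives
open Literature.MathematicalPhysics.QuantumFieldTheory.Balaban1983to89.Missing (partitionFn)
open Summit.QuantumFields.YangMills.Theorems.UV3UnitPartitionLowerOfPackage (resDensity_univ_eq unitEnvelope_of_halves)

/-! ## §1 Generic: the a.e. upper half of the unit envelope from five rows on a datum -/

/-- ★★ **(U″) FROM ROWS ON A DATUM** — for any `D : AlphaDataT3 F γ`: IF (41)′ holds `dV`-a.e. at the top level of every run (`ρ_K ≤ e^{−Ecst_K + Rm_K}·up_K`), the history
functional has print's shape AT THE TOP LEVEL (monotone on admissible histories, `LF(Φ + t) = eᵗ·LF(Φ)` — the two clauses of `LFShape`, asked only at `j = K`), the top remainders are bounded (`Rm_K ≤ CR`), the top interaction sums are bounded above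
at EVERY history (`Pint_K(h, W) ≤ CP`, (46)) and the TOP-LEVEL LARGE-FIELD CONTROL holds (`LF_K(W)[h ↦ e^{−mainT_K(h,W) + Zterm_K(h)}] ≤ e^{CZ}`, the B25 leaf at `k = K`), all
K-uniformly, THEN `ρ_K ≤ exp(−Ecst_K + (CR + CP + CZ))` `dV`-a.e. for every `K` — (41) p.266 with `Pint` pulled out of the exponent by monotonicity and the history sum resummed.
[cite: Balaban1985UV3, (41) p.266, (46) p.267, (5) p.256, pp.273–274] -/
theorem ae_emlDensity_top_le_of_rows {F : T3Family} {γ : ℝ} (D : AlphaDataT3 F γ)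
    (h41 : ∀ K : ℕ, Ineq41AE D K K)
    (hLFm : ∀ (K : ℕ) (W : GaugeField (F.P K) K (Matrix.specialUnitaryGroup (Fin 2) ℂ)) (Φ Ψ : D.Hist K K → ℝ),
      (∀ h, D.Adm K K h W → Φ h ≤ Ψ h) → D.LF K K W Φ ≤ D.LF K K W Ψ)
    (hLFt : ∀ (K : ℕ) (W : GaugeField (F.P K) K (Matrix.specialUnitaryGroup (Fin 2) ℂ)) (Φ : D.Hist K K → ℝ) (t : ℝ),
      D.LF K K W (fun h => Φ h + t) = Real.exp t * D.LF K K W Φ)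
    {CR : ℝ} (hRm : ∀ K : ℕ, D.Rm K K ≤ CR)
    {CP : ℝ} (hPint : ∀ (K : ℕ) (h : D.Hist K K) (W : GaugeField (F.P K) K (Matrix.specialUnitaryGroup (Fin 2) ℂ)), D.Pint K K h W ≤ CP)
    {CZ : ℝ} (hlf : ∀ (K : ℕ) (W : GaugeField (F.P K) K (Matrix.specialUnitaryGroup (Fin 2) ℂ)),
      D.LF K K W (fun h => -(D.mainT K K h W) + D.Zterm K K h) ≤ Real.exp CZ) :
    ∀ K : ℕ, ∀ᵐ W ∂fieldMeasure (F.P K) K (Matrix.specialUnitaryGroup (Fin 2) ℂ),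
      emlDensity F γ K K W ≤ Real.exp (-(D.Ecst K K) + (CR + CP + CZ)) := by
  intro K
  filter_upwards [h41 K] with W hW
  -- `up_K(W) ≤ e^{CP}·LF_K(W)[−mainT + Zterm] ≤ e^{CP}·e^{CZ}`
  have hmono : D.up K K W ≤ D.LF K K W (fun h => (-(D.mainT K K h W) + D.Zterm K K h) + CP) := by
    refine hLFm K W _ _ fun h _ => ?_
    have := hPint K h W
    linarith
  have hup : D.up K K W ≤ Real.exp CP * Real.exp CZ := by
    refine hmono.trans ?_
    rw [hLFt K W (fun h => -(D.mainT K K h W) + D.Zterm K K h) CP]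
    exact mul_le_mul_of_nonneg_left (hlf K W) (Real.exp_pos _).le
  have hup0 : 0 ≤ D.up K K W :=
    (mul_nonneg_iff_of_pos_left (Real.exp_pos _)).mp
      ((T3RestrictedUnitDensity.resDensity_nonneg F γ K Set.univ K W).trans hW)
  rw [← resDensity_univ_eq F γ K K]
  calc resDensity F γ K Set.univ K W
      ≤ Real.exp (-(D.Ecst K K) + D.Rm K K) * D.up K K W := hW
    _ ≤ Real.exp (-(D.Ecst K K) + CR) * (Real.exp CP * Real.exp CZ) :=
        mul_le_mul (Real.exp_le_exp.mpr (by linarith [hRm K])) hup hup0 (Real.exp_pos _).le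
    _ = Real.exp (-(D.Ecst K K) + (CR + CP + CZ)) := by
        rw [← Real.exp_add, ← Real.exp_add]; ring_nf

/-! ## §2 At the socket datum `dataT3`: every row by name except the top-level large-field row -/

section Socket

variable {F : T3Family} {𝔠 : AlphaConsts F.L (suGroupModel 2).N}
  (h : AlphaInputsT3AC.Of F 𝔠) (γ : ℝ) (hγ : 0 < γ) (hγ1 : γ ≤ (min 𝔠.gamma0 1) ^ 2) (π : AlphaInputsT3AC.PolymerT3 F)

/-- ★★ **(U″) MODULO THE PACKAGE AND THE TOP-LEVEL LARGE-FIELD ROW**: under `AlphaInputsT3AC.Of F 𝔠` at `γ ∈ (0, (min γ₀ 1)²]`, IF for every run the top-level history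
functional of the socket datum obeys `LF_K(W)[h ↦ e^{−mainT_K(h,W) + Zterm_K(h)}] ≤ e^{CZ}` with ONE `CZ` (the END theorem's B25 leaf at `k = K`; `|T₁^{(K)}| = (2L^m)³` is
run-independent), THEN `∃ Cu', ∀ K, ρ_K ≤ exp(−Ecst K K + Cu')` `dV`-a.e. — rows BY NAME: (41)′ ✓`dataT3_ineq41AE`, shape ✓`dataT3_lfShape`, remainder ✓`dataT3_exp_two_Rm_le`
(+ `Rm_nonneg ∘ dataT3_rmSize` ⇒ `Rm_K ≤ log CRm`), (46) at every history ✓`AlphaInputsT3ACPint.abs_dataT3_Pint_top_le`. [cite: Balaban1985UV3, (41) p.266, (46) p.267, (5) p.256, pp.273–274] -/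
theorem _root_.Summit.QuantumFields.YangMills.Theorems.AlphaInputsT3AC.Of.ae_emlDensity_top_le_of_lf
    (hlf : ∃ CZ : ℝ, ∀ (K : ℕ) (W : GaugeField (F.P K) K (Matrix.specialUnitaryGroup (Fin 2) ℂ)),
      (h.dataT3 γ hγ hγ1 π).LF K K W
          (fun hh => -((h.dataT3 γ hγ hγ1 π).mainT K K hh W) + (h.dataT3 γ hγ hγ1 π).Zterm K K hh) ≤ Real.exp CZ) :
    ∃ Cu' : ℝ, ∀ K : ℕ, ∀ᵐ W ∂fieldMeasure (F.P K) K (Matrix.specialUnitaryGroup (Fin 2) ℂ),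
      emlDensity F γ K K W ≤ Real.exp (-((h.dataT3 γ hγ hγ1 π).Ecst K K) + Cu') := by
  obtain ⟨CZ, hCZ⟩ := hlf
  obtain ⟨CRm, hCRm⟩ := h.dataT3_exp_two_Rm_le γ hγ hγ1 π
  have hCRm0 : 0 < CRm := (Real.exp_pos _).trans_le (hCRm 0 0 le_rfl)
  have hRm : ∀ K : ℕ, (h.dataT3 γ hγ hγ1 π).Rm K K ≤ Real.log CRm := fun K => by
    have h2 : Real.exp (2 * (h.dataT3 γ hγ hγ1 π).Rm K K) ≤ CRm := hCRm K K le_rfl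
    have h0 : 0 ≤ (h.dataT3 γ hγ hγ1 π).Rm K K := Rm_nonneg (h.dataT3_rmSize γ hγ hγ1 π) le_rfl
    have h1 : Real.exp ((h.dataT3 γ hγ hγ1 π).Rm K K) ≤ Real.exp (2 * (h.dataT3 γ hγ hγ1 π).Rm K K) :=
      Real.exp_le_exp.mpr (by linarith)
    exact (Real.le_log_iff_exp_le hCRm0).mpr (h1.trans h2)
  exact ⟨Real.log CRm + 𝔠.C46 * (𝔠.M₁ : ℝ) ^ 3 * θBal F.L γ 𝔠.b₀ 𝔠.p₀ 1 ^ 2 * (2 * (F.L : ℝ) ^ F.m) ^ 3 + CZ,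
    ae_emlDensity_top_le_of_rows (h.dataT3 γ hγ hγ1 π) (fun K => h.dataT3_ineq41AE γ hγ hγ1 π K K le_rfl)
      (fun K W Φ Ψ hle => (h.dataT3_lfShape γ hγ hγ1 π).1 K K W Φ Ψ hle)
      (fun K W Φ t => (h.dataT3_lfShape γ hγ hγ1 π).2 K K W Φ t) hRm
      (fun K hh W => (abs_le.mp (h.abs_dataT3_Pint_top_le γ hγ hγ1 π K hh W)).2) hCZ⟩

/-! ## §3 The letter of `stub_unitEnvelope` per `(F, γ)` from the package and two rows -/

/-- ★★★ **THE UNIT ENVELOPE LETTER PER `(F, γ)` FROM THE PACKAGE, THE TOP-LEVEL LARGE-FIELD ROW AND THE MAIN-TERM ROW**: `∃ Cl', ∀ K, ∀ᵐ V, ρ_K V ≤ e^{Cl'}·Z_K`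
— ✓`unitEnvelope_of_halves` at the anchor `E K := Ecst K K` (print's own vacuum-energy constant, which cancels) over the upper half `ae_emlDensity_top_le_of_lf` (this file) and the
lower half ✓`AlphaInputsT3ACPint.exp_Ecst_le_partitionFn_of_package_of_main` (✓`UV3UnitPartitionLowerOfPackage` + (46)). [cite: Balaban1985UV3, (5)–(6) pp.256–257, (41) p.266, (47) p.267] -/
theorem _root_.Summit.QuantumFields.YangMills.Theorems.AlphaInputsT3AC.Of.unitEnvelope_letter_of_lf_of_main
    (hlf : ∃ CZ : ℝ, ∀ (K : ℕ) (W : GaugeField (F.P K) K (Matrix.specialUnitaryGroup (Fin 2) ℂ)),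
      (h.dataT3 γ hγ hγ1 π).LF K K W
          (fun hh => -((h.dataT3 γ hγ hγ1 π).mainT K K hh W) + (h.dataT3 γ hγ hγ1 π).Zterm K K hh) ≤ Real.exp CZ)
    (hMain : ∃ Cm : ℝ, ∀ (K : ℕ) (W : GaugeField (F.P K) K (Matrix.specialUnitaryGroup (Fin 2) ℂ)),
      PlaqSmall (θBal F.L γ 𝔠.b₀ 𝔠.p₀ 0) W →
        (h.dataT3 γ hγ hγ1 π).mainT K K ((h.dataT3 γ hγ hγ1 π).triv K K) W ≤ Cm) :
    ∃ Cl' : ℝ, ∀ K : ℕ, ∀ᵐ V ∂fieldMeasure (F.P K) K (Matrix.specialUnitaryGroup (Fin 2) ℂ),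
      emlDensity F γ K K V ≤
        Real.exp Cl' * partitionFn (G := Matrix.specialUnitaryGroup (Fin 2) ℂ) (F.P K) ((F.scheme ℰp γ).β K) :=
  unitEnvelope_of_halves F hγ.le (fun K => (h.dataT3 γ hγ hγ1 π).Ecst K K)
    (h.ae_emlDensity_top_le_of_lf γ hγ hγ1 π hlf) (h.exp_Ecst_le_partitionFn_of_package_of_main γ hγ hγ1 π hMain)

end Socket

/-! ## §4 The registered `stub_unitEnvelope` text from three named rows -/

/-- ★★★ **`PinnedStability.stub_unitEnvelope` (the 19936 skeleton of record's S-low, its text VERBATIM) FROM THREE NAMED ROWS**: the T3 (α) socket for every block size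
(`∀ L, AlphaInputsT3AC L` — the UV3 node, closed modulo its Tier A–E inputs), the TOP-LEVEL LARGE-FIELD ROW for each package datum (the END theorem's B25 text at `k = K`; =
R-19936-S's resummation organ at the trivial pin, named once) and the TOP-LEVEL MAIN-TERM ROW (⟸ the membership «`U_min(triv, W) ∈ regFibrePr F 0 K ε₀ V`», the EX lane);
`γ₁ := (min γ₀ 1)²` of the socket's record for `L`.  A FACE (conclusion = the stub's statement, hypotheses = rows); it closes nothing: (41)∧(47) for the `blockAvg ℰp` tower,
the large-field control for its uncapped masses and [Balaban1985Variational] Thm 1 (8) are exactly the content. [cite: Balaban1985UV3, Thm 1 (5) p.256, (41) p.266, (47) p.267, pp.273–274] -/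
theorem stub_unitEnvelope_of_package_of_lf_of_main (π : ∀ F : T3Family, AlphaInputsT3AC.PolymerT3 F)
    (hpkg : ∀ L : ℕ, AlphaInputsT3AC L)
    (hlf : ∀ (F : T3Family) (𝔠 : AlphaConsts F.L (suGroupModel 2).N) (h : AlphaInputsT3AC.Of F 𝔠) (γ : ℝ) (hγ : 0 < γ)
      (hγ1 : γ ≤ (min 𝔠.gamma0 1) ^ 2), ∃ CZ : ℝ, ∀ (K : ℕ) (W : GaugeField (F.P K) K (Matrix.specialUnitaryGroup (Fin 2) ℂ)),
        (h.dataT3 γ hγ hγ1 (π F)).LF K K W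
            (fun hh => -((h.dataT3 γ hγ hγ1 (π F)).mainT K K hh W) + (h.dataT3 γ hγ hγ1 (π F)).Zterm K K hh) ≤ Real.exp CZ)
    (hMain : ∀ (F : T3Family) (𝔠 : AlphaConsts F.L (suGroupModel 2).N) (h : AlphaInputsT3AC.Of F 𝔠) (γ : ℝ) (hγ : 0 < γ)
      (hγ1 : γ ≤ (min 𝔠.gamma0 1) ^ 2), ∃ Cm : ℝ, ∀ (K : ℕ) (W : GaugeField (F.P K) K (Matrix.specialUnitaryGroup (Fin 2) ℂ)),
        PlaqSmall (θBal F.L γ 𝔠.b₀ 𝔠.p₀ 0) W →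
          (h.dataT3 γ hγ hγ1 (π F)).mainT K K ((h.dataT3 γ hγ hγ1 (π F)).triv K K) W ≤ Cm) :
    ∀ (L : ℕ), ∃ γ₁ : ℝ, 0 < γ₁ ∧ ∀ (F : T3Family) (γ : ℝ), F.L = L → 0 < γ → γ ≤ γ₁ →
      ∃ Cl : ℝ, ∀ K : ℕ, ∀ᵐ V ∂(fieldMeasure (F.P K) K (Matrix.specialUnitaryGroup (Fin 2) ℂ)),
        emlDensity F γ K K V ≤
          Real.exp Cl * partitionFn (G := Matrix.specialUnitaryGroup (Fin 2) ℂ) (F.P K) ((F.scheme ℰp γ).β K) := by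
  intro L
  obtain ⟨𝔠, h𝔠⟩ := hpkg L
  refine ⟨(min 𝔠.gamma0 1) ^ 2, pow_pos (lt_min 𝔠.gamma0_pos one_pos) 2, fun F γ hFL hγ hγle => ?_⟩
  subst hFL
  exact (h𝔠 F rfl).unitEnvelope_letter_of_lf_of_main γ hγ hγle (π F) (hlf F 𝔠 (h𝔠 F rfl) γ hγ hγle)
    (hMain F 𝔠 (h𝔠 F rfl) γ hγ hγle)

/-! ## §5 (v1.1, APPEND — ★★OWNER RULING №32 letters, `ym-ust-19936-w6` g7 2026-08-29T23:11Z note) The large-field row read `dV`-ALMOST EVERYWHERE: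
the history functional `LF_K(W) = Σ_h m_K(h,W)·e^{Φ}` of the socket datum sums POINT VALUES of Radon–Nikodym versions (the AC masses), so the №32-clean display of the
top-level large-field leaf is `∀ K, ∀ᵐ W, LF_K(W)[−mainT + Zterm] ≤ e^{CZ}`, not `∀ W`; every conclusion above is already a.e., so nothing is lost (one more `filter_upwards`). -/

/-- ★★ **(U″) FROM ROWS ON A DATUM, THE LARGE-FIELD ROW A.E.** — as `ae_emlDensity_top_le_of_rows` with `hlf` weakened to `∀ K, ∀ᵐ W, LF_K(W)[h ↦ e^{−mainT + Zterm}] ≤ e^{CZ}`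
(RULING №32 letter: the masses inside `LF` are Radon–Nikodym versions). [cite: Balaban1985UV3, (41) p.266, (46) p.267, (5) p.256, pp.273–274] -/
theorem ae_emlDensity_top_le_of_rows_ae {F : T3Family} {γ : ℝ} (D : AlphaDataT3 F γ)
    (h41 : ∀ K : ℕ, Ineq41AE D K K)
    (hLFm : ∀ (K : ℕ) (W : GaugeField (F.P K) K (Matrix.specialUnitaryGroup (Fin 2) ℂ)) (Φ Ψ : D.Hist K K → ℝ),
      (∀ h, D.Adm K K h W → Φ h ≤ Ψ h) → D.LF K K W Φ ≤ D.LF K K W Ψ)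
    (hLFt : ∀ (K : ℕ) (W : GaugeField (F.P K) K (Matrix.specialUnitaryGroup (Fin 2) ℂ)) (Φ : D.Hist K K → ℝ) (t : ℝ),
      D.LF K K W (fun h => Φ h + t) = Real.exp t * D.LF K K W Φ)
    {CR : ℝ} (hRm : ∀ K : ℕ, D.Rm K K ≤ CR)
    {CP : ℝ} (hPint : ∀ (K : ℕ) (h : D.Hist K K) (W : GaugeField (F.P K) K (Matrix.specialUnitaryGroup (Fin 2) ℂ)), D.Pint K K h W ≤ CP)
    {CZ : ℝ} (hlf : ∀ K : ℕ, ∀ᵐ W ∂fieldMeasure (F.P K) K (Matrix.specialUnitaryGroup (Fin 2) ℂ),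
      D.LF K K W (fun h => -(D.mainT K K h W) + D.Zterm K K h) ≤ Real.exp CZ) :
    ∀ K : ℕ, ∀ᵐ W ∂fieldMeasure (F.P K) K (Matrix.specialUnitaryGroup (Fin 2) ℂ),
      emlDensity F γ K K W ≤ Real.exp (-(D.Ecst K K) + (CR + CP + CZ)) := by
  intro K
  filter_upwards [h41 K, hlf K] with W hW hlfW
  have hmono : D.up K K W ≤ D.LF K K W (fun h => (-(D.mainT K K h W) + D.Zterm K K h) + CP) := by
    refine hLFm K W _ _ fun h _ => ?_
    have := hPint K h W
    linarith
  have hup : D.up K K W ≤ Real.exp CP * Real.exp CZ := by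
    refine hmono.trans ?_
    rw [hLFt K W (fun h => -(D.mainT K K h W) + D.Zterm K K h) CP]
    exact mul_le_mul_of_nonneg_left hlfW (Real.exp_pos _).le
  have hup0 : 0 ≤ D.up K K W :=
    (mul_nonneg_iff_of_pos_left (Real.exp_pos _)).mp
      ((T3RestrictedUnitDensity.resDensity_nonneg F γ K Set.univ K W).trans hW)
  rw [← resDensity_univ_eq F γ K K]
  calc resDensity F γ K Set.univ K W
      ≤ Real.exp (-(D.Ecst K K) + D.Rm K K) * D.up K K W := hW
    _ ≤ Real.exp (-(D.Ecst K K) + CR) * (Real.exp CP * Real.exp CZ) :=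
        mul_le_mul (Real.exp_le_exp.mpr (by linarith [hRm K])) hup hup0 (Real.exp_pos _).le
    _ = Real.exp (-(D.Ecst K K) + (CR + CP + CZ)) := by
        rw [← Real.exp_add, ← Real.exp_add]; ring_nf

section SocketAE

variable {F : T3Family} {𝔠 : AlphaConsts F.L (suGroupModel 2).N}
  (h : AlphaInputsT3AC.Of F 𝔠) (γ : ℝ) (hγ : 0 < γ) (hγ1 : γ ≤ (min 𝔠.gamma0 1) ^ 2) (π : AlphaInputsT3AC.PolymerT3 F)

/-- ★★ **(U″) MODULO THE PACKAGE AND THE TOP-LEVEL LARGE-FIELD ROW READ A.E.** — `ae_emlDensity_top_le_of_lf` with `hlf` in the №32-clean `∀ K, ∀ᵐ W` letter.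
[cite: Balaban1985UV3, (41) p.266, (46) p.267, (5) p.256, pp.273–274] -/
theorem _root_.Summit.QuantumFields.YangMills.Theorems.AlphaInputsT3AC.Of.ae_emlDensity_top_le_of_lf_ae
    (hlf : ∃ CZ : ℝ, ∀ K : ℕ, ∀ᵐ W ∂fieldMeasure (F.P K) K (Matrix.specialUnitaryGroup (Fin 2) ℂ),
      (h.dataT3 γ hγ hγ1 π).LF K K W
          (fun hh => -((h.dataT3 γ hγ hγ1 π).mainT K K hh W) + (h.dataT3 γ hγ hγ1 π).Zterm K K hh) ≤ Real.exp CZ) :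
    ∃ Cu' : ℝ, ∀ K : ℕ, ∀ᵐ W ∂fieldMeasure (F.P K) K (Matrix.specialUnitaryGroup (Fin 2) ℂ),
      emlDensity F γ K K W ≤ Real.exp (-((h.dataT3 γ hγ hγ1 π).Ecst K K) + Cu') := by
  obtain ⟨CZ, hCZ⟩ := hlf
  obtain ⟨CRm, hCRm⟩ := h.dataT3_exp_two_Rm_le γ hγ hγ1 π
  have hCRm0 : 0 < CRm := (Real.exp_pos _).trans_le (hCRm 0 0 le_rfl)
  have hRm : ∀ K : ℕ, (h.dataT3 γ hγ hγ1 π).Rm K K ≤ Real.log CRm := fun K => by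
    have h2 : Real.exp (2 * (h.dataT3 γ hγ hγ1 π).Rm K K) ≤ CRm := hCRm K K le_rfl
    have h0 : 0 ≤ (h.dataT3 γ hγ hγ1 π).Rm K K := Rm_nonneg (h.dataT3_rmSize γ hγ hγ1 π) le_rfl
    have h1 : Real.exp ((h.dataT3 γ hγ hγ1 π).Rm K K) ≤ Real.exp (2 * (h.dataT3 γ hγ hγ1 π).Rm K K) :=
      Real.exp_le_exp.mpr (by linarith)
    exact (Real.le_log_iff_exp_le hCRm0).mpr (h1.trans h2)
  exact ⟨Real.log CRm + 𝔠.C46 * (𝔠.M₁ : ℝ) ^ 3 * θBal F.L γ 𝔠.b₀ 𝔠.p₀ 1 ^ 2 * (2 * (F.L : ℝ) ^ F.m) ^ 3 + CZ,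
    ae_emlDensity_top_le_of_rows_ae (h.dataT3 γ hγ hγ1 π) (fun K => h.dataT3_ineq41AE γ hγ hγ1 π K K le_rfl)
      (fun K W Φ Ψ hle => (h.dataT3_lfShape γ hγ hγ1 π).1 K K W Φ Ψ hle)
      (fun K W Φ t => (h.dataT3_lfShape γ hγ hγ1 π).2 K K W Φ t) hRm
      (fun K hh W => (abs_le.mp (h.abs_dataT3_Pint_top_le γ hγ hγ1 π K hh W)).2) hCZ⟩

/-- ★★★ **THE UNIT ENVELOPE LETTER PER `(F, γ)` WITH THE LARGE-FIELD ROW READ A.E.** — `unitEnvelope_letter_of_lf_of_main` in the №32-clean letter.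
[cite: Balaban1985UV3, (5)–(6) pp.256–257, (41) p.266, (47) p.267] -/
theorem _root_.Summit.QuantumFields.YangMills.Theorems.AlphaInputsT3AC.Of.unitEnvelope_letter_of_lf_ae_of_main
    (hlf : ∃ CZ : ℝ, ∀ K : ℕ, ∀ᵐ W ∂fieldMeasure (F.P K) K (Matrix.specialUnitaryGroup (Fin 2) ℂ),
      (h.dataT3 γ hγ hγ1 π).LF K K W
          (fun hh => -((h.dataT3 γ hγ hγ1 π).mainT K K hh W) + (h.dataT3 γ hγ hγ1 π).Zterm K K hh) ≤ Real.exp CZ)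
    (hMain : ∃ Cm : ℝ, ∀ (K : ℕ) (W : GaugeField (F.P K) K (Matrix.specialUnitaryGroup (Fin 2) ℂ)),
      PlaqSmall (θBal F.L γ 𝔠.b₀ 𝔠.p₀ 0) W →
        (h.dataT3 γ hγ hγ1 π).mainT K K ((h.dataT3 γ hγ hγ1 π).triv K K) W ≤ Cm) :
    ∃ Cl' : ℝ, ∀ K : ℕ, ∀ᵐ V ∂fieldMeasure (F.P K) K (Matrix.specialUnitaryGroup (Fin 2) ℂ),
      emlDensity F γ K K V ≤
        Real.exp Cl' * partitionFn (G := Matrix.specialUnitaryGroup (Fin 2) ℂ) (F.P K) ((F.scheme ℰp γ).β K) :=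
  unitEnvelope_of_halves F hγ.le (fun K => (h.dataT3 γ hγ hγ1 π).Ecst K K)
    (h.ae_emlDensity_top_le_of_lf_ae γ hγ hγ1 π hlf) (h.exp_Ecst_le_partitionFn_of_package_of_main γ hγ hγ1 π hMain)

end SocketAE

/-- ★★★ **`PinnedStability.stub_unitEnvelope` (registered text VERBATIM) FROM THREE NAMED ROWS, THE LARGE-FIELD ROW READ A.E.** — `stub_unitEnvelope_of_package_of_lf_of_main` with
`hlf` in the №32-clean `∀ K, ∀ᵐ W` letter (the masses inside `LF` are Radon–Nikodym versions). [cite: Balaban1985UV3, Thm 1 (5) p.256, (41) p.266, (47) p.267, pp.273–274] -/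
theorem stub_unitEnvelope_of_package_of_lf_ae_of_main (π : ∀ F : T3Family, AlphaInputsT3AC.PolymerT3 F)
    (hpkg : ∀ L : ℕ, AlphaInputsT3AC L)
    (hlf : ∀ (F : T3Family) (𝔠 : AlphaConsts F.L (suGroupModel 2).N) (h : AlphaInputsT3AC.Of F 𝔠) (γ : ℝ) (hγ : 0 < γ)
      (hγ1 : γ ≤ (min 𝔠.gamma0 1) ^ 2), ∃ CZ : ℝ, ∀ K : ℕ, ∀ᵐ W ∂fieldMeasure (F.P K) K (Matrix.specialUnitaryGroup (Fin 2) ℂ),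
        (h.dataT3 γ hγ hγ1 (π F)).LF K K W
            (fun hh => -((h.dataT3 γ hγ hγ1 (π F)).mainT K K hh W) + (h.dataT3 γ hγ hγ1 (π F)).Zterm K K hh) ≤ Real.exp CZ)
    (hMain : ∀ (F : T3Family) (𝔠 : AlphaConsts F.L (suGroupModel 2).N) (h : AlphaInputsT3AC.Of F 𝔠) (γ : ℝ) (hγ : 0 < γ)
      (hγ1 : γ ≤ (min 𝔠.gamma0 1) ^ 2), ∃ Cm : ℝ, ∀ (K : ℕ) (W : GaugeField (F.P K) K (Matrix.specialUnitaryGroup (Fin 2) ℂ)),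
        PlaqSmall (θBal F.L γ 𝔠.b₀ 𝔠.p₀ 0) W →
          (h.dataT3 γ hγ hγ1 (π F)).mainT K K ((h.dataT3 γ hγ hγ1 (π F)).triv K K) W ≤ Cm) :
    ∀ (L : ℕ), ∃ γ₁ : ℝ, 0 < γ₁ ∧ ∀ (F : T3Family) (γ : ℝ), F.L = L → 0 < γ → γ ≤ γ₁ →
      ∃ Cl : ℝ, ∀ K : ℕ, ∀ᵐ V ∂(fieldMeasure (F.P K) K (Matrix.specialUnitaryGroup (Fin 2) ℂ)),
        emlDensity F γ K K V ≤
          Real.exp Cl * partitionFn (G := Matrix.specialUnitaryGroup (Fin 2) ℂ) (F.P K) ((F.scheme ℰp γ).β K) := by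
  intro L
  obtain ⟨𝔠, h𝔠⟩ := hpkg L
  refine ⟨(min 𝔠.gamma0 1) ^ 2, pow_pos (lt_min 𝔠.gamma0_pos one_pos) 2, fun F γ hFL hγ hγle => ?_⟩
  subst hFL
  exact (h𝔠 F rfl).unitEnvelope_letter_of_lf_ae_of_main γ hγ hγle (π F) (hlf F 𝔠 (h𝔠 F rfl) γ hγ hγle)
    (hMain F 𝔠 (h𝔠 F rfl) γ hγ hγle)

end Summit.QuantumFields.YangMills.Theorems.UV3UnitDensityUpperOfPackage

end
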